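import Summits.AtomisticToContinuum.HydrodynamicLimit.Theses.JParityClosure
import HarnessLib

/-!
# Line `Sketch` — the REPAIRED kinetic hypothesis the planner is asked to file (lead c1, cycle 2)

Companion of `Lines/SketchDead.md` §5 (crux `JParityClosure.ParityBandClosure`, stmt-AtomisticToContinuum-17608).
The line died because `OddContactSymmetry` (stmt-17722) AS TYPED tests the Metropolis-reweighted collision record only
against FIXED `J`-odd marks `Ψ(n̂, v, w)`, which after Young-measure mixing of mesoscopic cells constrain only the
fibre-AVERAGED record (two-fibre counter-model, p141493). The repair below lets the odd mark depend on the SURPRISAL JUMP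
`F` of the collision as well — `Ψ(n̂, v⁻, w⁻, F)` with `Ψ(−n̂, v′, w′, −f) = −Ψ(n̂, v, w, f)` — and changes NOTHING else
(the `let`-chain is byte-identical to the route declaration). With `Ψ = φ(F)` (`φ` odd) its limit content is exactly the
hypothesis of the landed, mixing-proof `ParityBandClosureDetailedBalance.ae_eq_zero_of_balance_of_odd_jump_tests`
(p141247): fibre-summed `∫ φ(F) min(1,e^{−F}) dκ = 0` + fibre-summed balance `∫ F dκ = 0` ⇒ `F = 0` on the record of
EVERY fibre (zero Metropolis rejection mass), which is what `stub_maxwellDefectVanishes` needs.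

* `OddContactSymmetryJump` — the re-typed hypothesis (a `Prop`; NOT asserted; for the planner to file as the
  restatement of 17722; physically the same claim: the reweighted incoming record is symmetric under time reversal of the
  collision, now tested against a class of marks rich enough for its consumer).
* `oddContactSymmetry_of_jump : OddContactSymmetryJump → OddContactSymmetry` — the restatement is a STRENGTHENING (marks
  that ignore the jump value), kernel-checked: the two statistics are definitionally equal for such marks.
* `PointwiseRateFloor` — the scale-`r` windowed form of `RateFloor` (stmt-13080) that `stub_isotropyOfMaxwellDefect` needs
  (`Lines/SketchDead.md` §3, counter-model 2), typed on the sister line's `PointwiseEnskogCollisions` window format.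
-/

noncomputable section

namespace Summit.AtomisticToContinuum.HydrodynamicLimit.Cruxes.ParityBandClosure.SketchRepair

open scoped BigOperators Topology Classical MeasureTheory ENNReal InnerProductSpace
open Filter Set MeasureTheory
open Summit.AtomisticToContinuum.HydrodynamicLimit.Theses

/-- **Odd contact symmetry with jump-dependent marks** (proposed restatement of `JParityClosure.OddContactSymmetry`,
stmt-AtomisticToContinuum-17722): VERBATIM the filed declaration except that the bounded continuous odd mark is a function
`Ψ(n̂, v⁻, w⁻, f)` of the impact direction, the pre-collisional pair AND a real argument `f`, odd under
`(n̂, v, w, f) ↦ (−n̂, v′, w′, −f)`, and is evaluated at `f = F z s i j`, the surprisal jump of the collision (the same `F`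
that enters the Metropolis weight `min 1 (exp (−F))`). Informally: the Metropolis-reweighted pre-shock collision record,
MARKED BY ITS OWN SURPRISAL JUMP, is symmetric under time reversal of the collision, in probability, in band. -/
def OddContactSymmetryJump : Prop :=
  ∃ η₀ : ℝ, 0 < η₀ ∧ ∀ (a₀ θ₀ : Literature.MathematicalPhysics.KineticTheory.T3 → ℝ) (u₀ : Literature.MathematicalPhysics.KineticTheory.T3 → Literature.MathematicalPhysics.KineticTheory.V3), Continuous a₀ → Continuous θ₀ → Continuous u₀ → (∀ x, 0 < a₀ x) → (∀ x, 0 < θ₀ x) → ∃ σ₀ : ℝ, 0 < σ₀ ∧ ∀ σ : ℝ, 0 < σ → σ < σ₀ → ∀ (T : ℝ) (ρ θ : ℝ → Literature.MathematicalPhysics.KineticTheory.T3 → ℝ) (u : ℝ → Literature.MathematicalPhysics.KineticTheory.T3 → Literature.MathematicalPhysics.KineticTheory.V3), Literature.MathematicalPhysics.KineticTheory.IsHardSphereEulerSolution σ T ρ u θ → ∀ Φ : (N : ℕ) → Literature.Analysis.FluidPDE.HardSphereFlow (Literature.Analysis.FluidPDE.Torus.geometry (Fin 3)) (Literature.MathematicalPhysics.KineticTheory.hsDiameter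 σ N) (N + 1), Literature.MathematicalPhysics.KineticTheory.TendstoHydroFieldsAt (fun N => Literature.MathematicalPhysics.KineticTheory.localGibbsLaw σ a₀ u₀ θ₀ N (Φ N)) Φ ρ u θ 0 → ∀ τ : ℝ, 0 < τ → τ < T → ∀ χ : ℝ × UnitAddTorus (Fin 3) → ℝ, Continuous χ → ∀ g : ℝ → ℝ, Continuous g → (∀ a, η₀ ≤ a → g a = 0) → ∀ Ψ : EuclideanSpace ℝ (Fin 3) × EuclideanSpace ℝ (Fin 3) × EuclideanSpace ℝ (Fin 3) × ℝ → ℝ, Continuous Ψ → (∃ C : ℝ, ∀ q, |Ψ q| ≤ C) → (∀ (n v w : EuclideanSpace ℝ (Fin 3)) (f : ℝ), ‖n‖ = 1 → Ψ (-n, (Literature.Analysis.FluidPDE.reflectVel n (v, w)).1, (Literature.Analysis.FluidPDE.reflectVel n (v, w)).2, -f) = -Ψ (n, v, w, f)) → ∀ η δ : ℝ, 0 < η → 0 < δ → ∃ r₀ : ℝ, 0 < r₀ ∧ ∀ r ϑ : ℝ, 0 < r → r < r₀ → 0 < ϑ → ϑ < r₀ → ∃ N₀ : ℕ, ∀ N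 : ℕ, N₀ ≤ N → let ε := Literature.MathematicalPhysics.KineticTheory.hsDiameter σ N; let G := Literature.Analysis.FluidPDE.Torus.geometry (Fin 3); let γ := fun z (s : ℝ) => (Φ N).flow s z; let bx : UnitAddTorus (Fin 3) → UnitAddTorus (Fin 3) → ℝ := fun x y => 3 / (Real.pi * r ^ 3) * max (1 - Literature.Analysis.FluidPDE.Torus.euclidDist x y / r) 0; let ρm := fun z s (x₀ : UnitAddTorus (Fin 3)) => ∫ q, bx q.1 x₀ ∂(Literature.Analysis.FluidPDE.empiricalMeasure (γ z s)); let hm := fun z s (x₀ : UnitAddTorus (Fin 3)) (v : EuclideanSpace ℝ (Fin 3)) => ∫ q, bx q.1 x₀ * Literature.Analysis.FluidPDE.localMaxwellian 1 (ϑ ^ 2) v q.2 ∂(Literature.Analysis.FluidPDE.empiricalMeasure (γ z s)); let pv := fun z s (i j : Fin (N + 1)) => Literature.Analysis.FluidPDE.reflectVel (G.sepVec (γ z s i).1 (γ z s j).1) ((γ z s i).2, (γ z s j).2); let F := fun z s (i j : Fin (N + 1)) => Real.log (hm z s (γ z s i).1 (pv z s i j).1) + Real.log (hm z s (γ z s i).1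 (pv z s i j).2) - Real.log (hm z s (γ z s i).1 (γ z s i).2) - Real.log (hm z s (γ z s i).1 (γ z s j).2); let Kc := fun (Fn : Literature.Analysis.FluidPDE.Config (N + 1) (Fin 3) Literature.MathematicalPhysics.KineticTheory.T3 → ℝ → Fin (N + 1) → Fin (N + 1) → ℝ) z => ε / (N + 1 : ℝ) * ∑ᶠ (s : ℝ) (_ : s ∈ Literature.Analysis.FluidPDE.collisionTimes G ε (γ z) ∩ Set.Icc 0 τ), ∑ i : Fin (N + 1), ∑ j : Fin (N + 1), (if i ≠ j ∧ ‖G.sepVec (γ z s i).1 (γ z s j).1‖ = ε then Fn z s i j else 0); let D := fun z => Kc (fun z s i j => χ (s, (γ z s i).1) * g (σ ^ 3 * ρm z s (γ z s i).1) * (Ψ (ε⁻¹ • G.sepVec (γ z s i).1 (γ z s j).1, (pv z s i j).1, (pv z s i j).2, F z s i j) * min 1 (Real.exp (-F z s i j)))) z; Literature.MathematicalPhysics.KineticTheory.localGibbsLaw σ a₀ u₀ θ₀ N (Φ N) {z | η < |D z|} ≤ ENNReal.ofReal δ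

/-- The jump-marked odd contact symmetry implies the filed one (take marks that ignore the jump value; the two crux
statistics are then definitionally equal). [folklore] -/
theorem oddContactSymmetry_of_jump (h : OddContactSymmetryJump) : JParityClosure.OddContactSymmetry := by
  obtain ⟨η₀, hη₀, H⟩ := h
  refine ⟨η₀, hη₀, ?_⟩
  intro a₀ θ₀ u₀ ha hθ hu ha0 hθ0
  obtain ⟨σ₀, hσ₀, H⟩ := H a₀ θ₀ u₀ ha hθ hu ha0 hθ0
  refine ⟨σ₀, hσ₀, ?_⟩
  intro σ hσ hσ' T ρ θ u hE Φ h0 τ hτ hτT χ hχ g hg hg0 Ψ hΨ hΨb hΨodd η δ hη hδ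
  obtain ⟨C, hC⟩ := hΨb
  have hcont : Continuous fun q : EuclideanSpace ℝ (Fin 3) × EuclideanSpace ℝ (Fin 3) × EuclideanSpace ℝ (Fin 3) × ℝ =>
      (q.1, q.2.1, q.2.2.1) :=
    continuous_fst.prodMk ((continuous_fst.comp continuous_snd).prodMk
      (continuous_fst.comp (continuous_snd.comp continuous_snd)))
  exact H σ hσ hσ' T ρ θ u hE Φ h0 τ hτ hτT χ hχ g hg hg0 (fun q => Ψ (q.1, q.2.1, q.2.2.1)) (hΨ.comp hcont)
    ⟨C, fun q => hC _⟩ (fun n v w f hn => hΨodd n v w hn) η δ hη hδ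

/-- **Pointwise (scale-`r` windowed) rate floor** (proposed restatement of `JParityClosure.RateFloor`,
stmt-AtomisticToContinuum-13080, `Lines/SketchDead.md` §3/§5 R-b): the filed floor `K_N[χ Ξ] ≥ g₀ σ³ ∫∫ χ B^Ξ_r − η`
holds only for a FIXED localiser `χ`, hence after mixing only for the fibre-AVERAGED record; its consumer (thickness of the
record of EVERY cell's own law, `stub_isotropyOfMaxwellDefect`) needs it window by window at the scale `r` of the cone law
itself. Here the fixed `χ` is replaced by tent-in-time × cone-in-space windows of width `r` around `(t₀, x₀)` (the binders
of the sister line's `PointwiseEnskogCollisions`): `Kr` is the windowed normalised collision functional of the mark `Ξ`,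
`Br` the same window of the cone pair functional `B^Ξ_r`, and the deficit `(g₀ σ³ Br − Kr)₊` is small in `L¹(dt₀ dx₀)` in
probability (`N → ∞` then `r → 0`); everything else VERBATIM 13080. A `Prop`, not asserted. -/
def PointwiseRateFloor : Prop :=
  ∃ g₀ : ℝ, 0 < g₀ ∧ ∀ (a₀ θ₀ : Literature.MathematicalPhysics.KineticTheory.T3 → ℝ) (u₀ : Literature.MathematicalPhysics.KineticTheory.T3 → Literature.MathematicalPhysics.KineticTheory.V3), Continuous a₀ → Continuous θ₀ → Continuous u₀ → (∀ x, 0 < a₀ x) → (∀ x, 0 < θ₀ x) → ∃ σ₀ : ℝ, 0 < σ₀ ∧ ∀ σ : ℝ, 0 < σ → σ < σ₀ → ∀ Φ : (N : ℕ) → Literature.Analysis.FluidPDE.HardSphereFlow (Literature.Analysis.FluidPDE.Torus.geometry (Fin 3)) (Literature.MathematicalPhysics.KineticTheory.hsDiameter σ N) (N + 1), ∀ τ : ℝ, 0 < τ → ∀ Ξ : EuclideanSpace ℝ (Fin 3) × EuclideanSpace ℝ (Fin 3) × EuclideanSpace ℝ (Fin 3) → ℝ, Continuous Ξ → (∀ q,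 0 ≤ Ξ q) → (∃ C : ℝ, ∀ q, Ξ q ≤ C) → ∀ η δ : ℝ, 0 < η → 0 < δ → ∃ r₀ : ℝ, 0 < r₀ ∧ ∀ r : ℝ, 0 < r → r < r₀ → ∃ N₀ : ℕ, ∀ N : ℕ, N₀ ≤ N → let ε := Literature.MathematicalPhysics.KineticTheory.hsDiameter σ N; let G := Literature.Analysis.FluidPDE.Torus.geometry (Fin 3); let γ := fun z (s : ℝ) => (Φ N).flow s z; let bx : UnitAddTorus (Fin 3) → UnitAddTorus (Fin 3) → ℝ := fun x y => 3 / (Real.pi * r ^ 3) * max (1 - Literature.Analysis.FluidPDE.Torus.euclidDist x y / r) 0; let Θ := fun (Ξ : EuclideanSpace ℝ (Fin 3) × EuclideanSpace ℝ (Fin 3) × EuclideanSpace ℝ (Fin 3) → ℝ) (v w : EuclideanSpace ℝ (Fin 3)) => ∫ ω : Metric.sphere (0 : EuclideanSpace ℝ (Fin 3)) 1, Ξ ((ω : EuclideanSpace ℝ (Fin 3)), v, w) * Literature.MathematicalPhysics.KineticTheory.hardSphereKernel (w, v) ω ∂Literature.MathematicalPhysics.KineticTheory.sphereMeasure; let B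 := fun Ξ z s (x₀ : UnitAddTorus (Fin 3)) => ∫ p, bx p.1.1 x₀ * bx p.2.1 x₀ * Θ Ξ p.1.2 p.2.2 ∂((Literature.Analysis.FluidPDE.empiricalMeasure (γ z s)).prod (Literature.Analysis.FluidPDE.empiricalMeasure (γ z s))); let pv := fun z s (i j : Fin (N + 1)) => Literature.Analysis.FluidPDE.reflectVel (G.sepVec (γ z s i).1 (γ z s j).1) ((γ z s i).2, (γ z s j).2); let Kc := fun (Fn : Literature.Analysis.FluidPDE.Config (N + 1) (Fin 3) Literature.MathematicalPhysics.KineticTheory.T3 → ℝ → Fin (N + 1) → Fin (N + 1) → ℝ) z => ε / (N + 1 : ℝ) * ∑ᶠ (s : ℝ) (_ : s ∈ Literature.Analysis.FluidPDE.collisionTimes G ε (γ z) ∩ Set.Icc 0 τ), ∑ i : Fin (N + 1), ∑ j : Fin (N + 1), (if i ≠ j ∧ ‖G.sepVec (γ z s i).1 (γ z s j).1‖ = ε then Fn z s i j else 0); let bt : ℝ → ℝ := fun a => r⁻¹ * max (1 - |a| / r) 0; let Kr := fun z (t₀ : ℝ) (x₀ : UnitAddTorus (Fin 3)) => Kc (fun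 z s i j => bt (s - t₀) * bx (γ z s i).1 x₀ * Ξ (ε⁻¹ • G.sepVec (γ z s i).1 (γ z s j).1, (pv z s i j).1, (pv z s i j).2)) z; let Br := fun z (t₀ : ℝ) (x₀ : UnitAddTorus (Fin 3)) => ∫ s in Set.Icc (0 : ℝ) τ, bt (s - t₀) * ∫ x : UnitAddTorus (Fin 3), bx x x₀ * B Ξ z s x; Literature.MathematicalPhysics.KineticTheory.localGibbsLaw σ a₀ u₀ θ₀ N (Φ N) {z | η < ∫ t₀ in Set.Icc (0 : ℝ) τ, ∫ x₀ : UnitAddTorus (Fin 3), max (g₀ * σ ^ 3 * Br z t₀ x₀ - Kr z t₀ x₀) 0} ≤ ENNReal.ofReal δ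

end Summit.AtomisticToContinuum.HydrodynamicLimit.Cruxes.ParityBandClosure.SketchRepair

end
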